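import Summits.KontsevichZagierPeriods.KontsevichZagierPeriods.Theses.FermatIsogeny
import Summits.KontsevichZagierPeriods.KontsevichZagierPeriods.Theorems.TerasomaMultiplicationMultiplicationAccessibleStubBetaReassoc
import Literature.NumberTheory.Transcendental.KZRelationsLE
import Literature.NumberTheory.Transcendental.KZCubeProducts
import Literature.NumberTheory.Transcendental.KZLogCalculusProofs
import Literature.NumberTheory.Transcendental.KZProductIdeal

/-!
# `BetaProductSector` (stmt-KontsevichZagierPeriods-3898), line `birth` — stub `stub_dirichletReassociation`

The DIRICHLET RE-ASSOCIATION seam of the birth skeleton of the crux `BetaProductSector` (route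
FermatIsogeny, rank 4): for positive rationals `a, b, k` and a real-algebraic weight `c`, the two pinned
product representations
`r  = [(0,1)², c · x^{a-1}(1-x)^{b-1} · y^{a+b-1}(1-y)^{k-1}]` and
`r' = [(0,1)², c · x^{a-1}(1-x)^{b+k-1} · y^{b-1}(1-y)^{k-1}]`
(values `c · B(a,b)B(a+b,k) = c · B(a,b+k)B(b,k) = c · Γ(a)Γ(b)Γ(k)/Γ(a+b+k)`, Andrews–Askey–Roy 1999
Thm 1.8.1) are `KZ.Equivalent`.

Proof (a corollary of the PROVED `MultiplicationAccessible.stub_betaReassoc`, the unweighted Dirichlet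
re-association through the polar / linear charts of the Dirichlet simplex):
1. unweighted representatives `u = [(0,1)², x^{a-1}(1-x)^{b-1} y^{a+b-1}(1-y)^{k-1}]` and
   `w = [(0,1)², x^{b-1}(1-x)^{k-1} y^{a-1}(1-y)^{b+k-1}]` exist (`KZ.exists_cubeBetaRep`) and
   `u ∼ w` is `stub_betaReassoc a b k`;
2. the coordinate swap `w.reindex (Equiv.swap 0 1)` is pinned as the unweighted `r'`-shape and is one
   change of variables away from `w` (`KZ.of_sub_of_reindex_mem_relations`);
3. scaling by `c` preserves equivalence (`KZ.Equivalent.constMul`);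
4. `r` and `u.constMul c`, resp. `r'` and `(w.reindex _).constMul c`, are pinned alike, hence equivalent by
   one integrand-additivity move (`KZ.of_sub_of_mem_relations_of_eqOn`).
The weight `c` may vanish: the scaling route is uniform in `c`.

References: Kontsevich–Zagier 2001 §1.2 (rules (1), (2)); Andrews–Askey–Roy 1999 Thm 1.8.1.
-/

noncomputable section

open MeasureTheory Set

namespace Summit.KontsevichZagierPeriods.FermatIsogeny.BetaProductSectorStubs

open Literature.NumberTheory.Transcendental
open Literature.NumberTheory.Transcendental.KZ
open Summit.KontsevichZagierPeriods.TerasomaMultiplication.MultiplicationAccessible (stub_betaReassoc)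

namespace DirichletReassoc

/-- The unweighted Beta box `[(0,1)², x^{a-1}(1-x)^{b-1} · y^{e-1}(1-y)^{d-1}]` EXISTS as a
Kontsevich–Zagier integral representation for positive rational data (the cube Beta representation of
`(![a,e], ![b,d])`, `KZ.exists_cubeBetaRep`), in the bracketing of `stub_betaReassoc`.
[cite: KontsevichZagier2001, §1.1] -/
theorem exists_box (a b e d : ℚ) (ha : 0 < a) (hb : 0 < b) (he : 0 < e) (hd : 0 < d) :
    ∃ u : KZ.IntegralRep 2, u.domain = {x | ∀ i, x i ∈ Set.Ioo (0:ℝ) 1} ∧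
      Set.EqOn u.integrand (fun z => (z 0) ^ ((a:ℝ) - 1) * (1 - z 0) ^ ((b:ℝ) - 1) *
        ((z 1) ^ ((e:ℝ) - 1) * (1 - z 1) ^ ((d:ℝ) - 1))) u.domain := by
  obtain ⟨u, hud, hui⟩ := KZ.exists_cubeBetaRep (N := 2) ![a, e] ![b, d]
    (Fin.forall_fin_two.2 ⟨⟨ha, hb⟩, ⟨he, hd⟩⟩)
  refine ⟨u, hud, fun z hz => ?_⟩
  rw [hui hz]
  simp only [Fin.prod_univ_two, Matrix.cons_val_zero, Matrix.cons_val_one]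

/-- The coordinate swap of a representation pinned on the open box `(0,1)²` is pinned on the open box
`(0,1)²`. [folklore] -/
theorem swap_domain (w : KZ.IntegralRep 2) (hwd : w.domain = {x | ∀ i, x i ∈ Set.Ioo (0:ℝ) 1}) :
    (w.reindex (Equiv.swap (0 : Fin 2) 1)).domain = {x | ∀ i, x i ∈ Set.Ioo (0:ℝ) 1} := by
  ext z
  simp only [KZ.IntegralRep.reindex_domain, hwd, Set.mem_setOf_eq]
  constructor
  · intro h i
    simpa using h (Equiv.swap (0 : Fin 2) 1 i)
  · intro h i
    exact h _

/-- Two representations on the same domain whose integrands agree there with `c · f` resp. are the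
`c`-scaling of one agreeing with `f` are equivalent (one integrand-additivity move,
`KZ.of_sub_of_mem_relations_of_eqOn`, against `IntegralRep.constMul`).
[cite: KontsevichZagier2001, §1.2 rule (1)] -/
theorem equivalent_constMul_of_eqOn {f : (Fin 2 → ℝ) → ℝ} (c : ℝ) (hc : IsAlgebraic ℚ c)
    (r u : KZ.IntegralRep 2) (hd : u.domain = r.domain)
    (hri : Set.EqOn r.integrand (fun z => c * f z) r.domain) (hui : Set.EqOn u.integrand f u.domain) :
    KZ.Equivalent r (u.constMul c hc) := by
  refine KZ.of_sub_of_mem_relations_of_eqOn (by rw [KZ.IntegralRep.domain_constMul, hd]) ?_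
  intro z hz
  have hzu : z ∈ u.domain := by rw [hd]; exact hz
  rw [hri hz, KZ.IntegralRep.integrand_constMul]
  simp only [hui hzu]

end DirichletReassoc

open DirichletReassoc in
/-- **Stub `stub_dirichletReassociation` — Dirichlet re-association in the calculus of moves**, general
`(a, b, k)` with a real-algebraic weight `c`:
`[(0,1)², c x^{a-1}(1-x)^{b-1} y^{a+b-1}(1-y)^{k-1}] ∼ [(0,1)², c x^{a-1}(1-x)^{b+k-1} y^{b-1}(1-y)^{k-1}]`
(`B(a,b)B(a+b,k) = B(a,b+k)B(b,k)`). Chain: pin `r` to the `c`-scaling of the unweighted box `u`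
(rule (1)); `u ∼ w` by the unweighted Dirichlet re-association `stub_betaReassoc` (polar and linear
charts of the Dirichlet simplex, rule (2)); swap the coordinates of `w` (rule (2)); scale the whole chain
by `c` (`KZ.Equivalent.constMul`); pin `r'` to the result (rule (1)).
[cite: AndrewsAskeyRoy1999, Thm 1.8.1] -/
theorem stub_dirichletReassociation : ∀ (a b k : ℚ) (c : ℝ), 0 < a → 0 < b → 0 < k → IsAlgebraic ℚ c → ∀ (r r' : Literature.NumberTheory.Transcendental.KZ.IntegralRep 2), r.domain = {x | ∀ i, x i ∈ Set.Ioo (0:ℝ) 1} → Set.EqOn r.integrand (fun x => c * (x 0) ^ ((a:ℝ) - 1) * (1 - x 0) ^ ((b:ℝ) - 1) * (x 1) ^ (((a + b : ℚ):ℝ) - 1) * (1 - x 1) ^ ((k:ℝ) - 1)) r.domain → r'.domain = {x | ∀ i, x i ∈ Set.Ioo (0:ℝ) 1} → Set.EqOn r'.integrand (fun x => c * (x 0) ^ ((a:ℝ) - 1) * (1 - x 0) ^ (((b + k : ℚ):ℝ) - 1) * (x 1) ^ ((b:ℝ) - 1) * (1 - x 1) ^ ((k:ℝ) - 1)) r'.domain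 → Literature.NumberTheory.Transcendental.KZ.Equivalent r r' := by
  intro a b k c ha hb hk hc r r' hrd hri hr'd hr'i
  -- (1) unweighted representatives `u`, `w` and the unweighted Dirichlet re-association `u ∼ w`
  obtain ⟨u, hud, hui⟩ := exists_box a b (a + b) k ha hb (add_pos ha hb) hk
  obtain ⟨w, hwd, hwi⟩ := exists_box b k a (b + k) hb hk ha (add_pos hb hk)
  have huw : KZ.Equivalent u w := by
    refine stub_betaReassoc a b k ha hb hk u w hud (fun z hz => ?_) hwd (fun z hz => ?_)
    · simpa using hui hz
    · simpa using hwi hz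
  -- (2) the coordinate swap of `w`: one change of variables, pinned as the unweighted `r'`-shape
  have hww : KZ.Equivalent w (w.reindex (Equiv.swap (0 : Fin 2) 1)) :=
    KZ.of_sub_of_reindex_mem_relations w _
  have hsi : Set.EqOn (w.reindex (Equiv.swap (0 : Fin 2) 1)).integrand
      (fun z => (z 0) ^ ((a:ℝ) - 1) * (1 - z 0) ^ (((b + k : ℚ):ℝ) - 1) * (z 1) ^ ((b:ℝ) - 1) *
        (1 - z 1) ^ ((k:ℝ) - 1)) (w.reindex (Equiv.swap (0 : Fin 2) 1)).domain := by
    intro z hz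
    have hz' : (fun i => z (Equiv.swap (0 : Fin 2) 1 i)) ∈ w.domain := hz
    rw [KZ.IntegralRep.reindex_integrand]
    simp only
    rw [hwi hz']
    simp only [Equiv.swap_apply_left, Equiv.swap_apply_right]
    push_cast
    ring
  -- (3) scale the chain `u ∼ w ∼ swap w` by `c`
  have hsc : KZ.Equivalent (u.constMul c hc) ((w.reindex (Equiv.swap (0 : Fin 2) 1)).constMul c hc) :=
    KZ.Equivalent.constMul c hc (huw.trans hww)
  -- (4) pin `r` and `r'`
  have hru : KZ.Equivalent r (u.constMul c hc) :=
    equivalent_constMul_of_eqOn c hc r u (hud.trans hrd.symm) (fun z hz => by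
      rw [hri hz]
      simp only [mul_assoc]) hui
  have hr's : KZ.Equivalent r' ((w.reindex (Equiv.swap (0 : Fin 2) 1)).constMul c hc) :=
    equivalent_constMul_of_eqOn c hc r' _ ((swap_domain w hwd).trans hr'd.symm) (fun z hz => by
      rw [hr'i hz]
      simp only [mul_assoc]) hsi
  exact hru.trans (hsc.trans hr's.symm)

end Summit.KontsevichZagierPeriods.FermatIsogeny.BetaProductSectorStubs

end
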